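import Summits.BirchSwinnertonDyer.BirchSwinnertonDyer.Theorems.Rank2Observatory2DescKillList
import Summits.BirchSwinnertonDyer.BirchSwinnertonDyer.Theorems.Rank2Observatory2DescKillLin
import HarnessLib

/-!
# KERNEL-2DESC — kills in VALIDITY form: any prime, any certificate shape (rank-2 observatory, cert-1 gen 25, v3.1)

HONEST FRAMING: per-curve certified theorems and census instruments; no claim on BSD in rank ≥ 2.

The landed kill layer (`Rank2Observatory2DescKillCheck` / `…2DescKill` / `…2DescKillList`) certifies that a
2-descent class `z` is locally insoluble at a prime `p` by ONE Boolean, the residue tree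
`TwoDescKill.killCheck p a b c z t₁ t₂ fuel`, and the list certificate `killListCheck` hard-wires both that
certificate shape and the prime list `killPrimes = [2, …, 23]` (their trees fit the kernel).  The K61 census
(cert-1 gen 25: every admissible class of the 1 533 'no kill' curves of the v3.0 tranches at every bad prime)
shows kills at LARGER bad primes (`p = 29 … 61` and beyond) of depth 2, whose plain trees cost
`(p⁴−1)/(p−1) + s·p³` evaluations — too many for one kernel fact, but certifiable by cheaper shapes (frontier
terms over prefix blocks; linear depth-2 witnesses).  This file separates WHAT a kill proves from HOW it is
checked:

* `TwoDescKill.KillValidAt p a b c z t₁ t₂ : Prop` — the quadric pair `killQ` of the class has no integer zero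
  primitive at `p` (exactly the conclusion of the landed `killCheck_sound`);
* `killValidAt_of_killCheck` — the landed tree certificate gives it, at ANY prime; `killValidAt_of_l2Check` — so does
  the linear depth-2 certificate `l2Check` of `Rank2Observatory2DescKillLin` (v3.1);
* `TwoDescCubic.not_isSquare_of_killValidAt` — `(x − θ)·z` is not a square in `K` (the landed
  `not_isSquare_of_killCheck` with the validity as hypothesis; same proof, [cite: Cassels1991LecturesEllipticCurves, §15]);
* `killListCheckV` — the list certificate WITHOUT the residue searches and without `killPrimes`: per entry
  `p` prime, `prodCoords = z`, `z ≠ 0` (decidable); the validity of each entry is a separate hypothesis, so a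
  row may discharge it by `killValidAt_of_killCheck _ (by decide +kernel)`, by a frontier term, or by any
  future certificate whose soundness theorem concludes `KillValidAt`;
* `admKillsV_sound` — the landed `admKills_sound` over `killListCheckV` + per-entry validity (same sieve
  `admKills`, so every cover-count clause downstream is unchanged); `killValidList_nil/cons` assemble the
  per-entry hypotheses kill by kill.

Sorry-free; nothing here is specific to a prime list or a search shape.
-/

-- single-conjunct summit: `Summit.BirchSwinnertonDyer.BirchSwinnertonDyer.…` repeats the name by design
set_option linter.dupNamespace false

noncomputable section

open scoped Classical NumberField

open Literature.NumberTheory.NumberFields Polynomial Module NumberField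

namespace Summit.BirchSwinnertonDyer.BirchSwinnertonDyer.Rank2Observatory

namespace TwoDescKill

/-- **Validity of a kill at `p`**: the quadric pair of the class `z` (with `θ`-coordinates `t₁, t₂`) has no
integer zero primitive at `p` — the 2-covering has no `ℚ_p`-point. The conclusion of `killCheck_sound`,
as a `Prop` independent of the certificate's shape. [cite: CremonaAlgorithms1997, §3.6] -/
def KillValidAt (p : ℕ) (a b c : ℤ) (z : ℤ × ℤ × ℤ) (t₁ t₂ : ℤ) : Prop :=
  ∀ v : ℤ × ℤ × ℤ × ℤ, ¬ ((p : ℤ) ∣ v.1 ∧ (p : ℤ) ∣ v.2.1 ∧ (p : ℤ) ∣ v.2.2.1 ∧ (p : ℤ) ∣ v.2.2.2) →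
    killQ a b c z t₁ t₂ v = 0 → False

/-- The landed residue-tree certificate gives validity, at any prime. [cite: CremonaAlgorithms1997, §3.6] -/
theorem killValidAt_of_killCheck {p : ℕ} (hp : p.Prime) {a b c : ℤ} {z : ℤ × ℤ × ℤ} {t₁ t₂ : ℤ}
    {fuel : ℕ} (h : killCheck p a b c z t₁ t₂ fuel = true) : KillValidAt p a b c z t₁ t₂ :=
  fun v hprim h0 => killCheck_sound hp h v hprim h0

/-- The linear depth-2 certificate (`Rank2Observatory2DescKillLin`) gives validity, at any prime.
[cite: CremonaAlgorithms1997, §3.6] -/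
theorem killValidAt_of_l2Check {p : ℕ} (hp : p.Prime) {a b c : ℤ} {z : ℤ × ℤ × ℤ} {t₁ t₂ : ℤ}
    {W : List ((ℤ × ℤ × ℤ × ℤ) × ℤ × ℤ)} (h : l2Check p a b c z t₁ t₂ W = true) : KillValidAt p a b c z t₁ t₂ :=
  fun v hprim h0 => l2Check_sound hp h v hprim h0

end TwoDescKill

namespace TwoDescCubic

open TwoDescKill

section Kill

variable {K : Type*} [Field K] [NumberField K] {a b c : ℤ} {α : K}

/-- **Kill soundness, validity form.** `K = ℚ(α)` a cubic field, `α³ + aα² + bα + c = 0`, `F` irreducible;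
`θ = t₀ + t₁α + t₂α²`, `z = z₀ + z₁α + z₂α² ≠ 0`. If the quadric pair of `z` has no integer zero primitive at
a prime `p`, then `(x − θ)·z` is not a square in `K` for any `x ∈ ℚ` (the landed `not_isSquare_of_killCheck`,
verbatim, with the validity in place of the tree certificate). [cite: Cassels1991LecturesEllipticCurves, §15] -/
theorem not_isSquare_of_killValidAt (hirr : Irreducible (MonicCubic.polyQ a b c))
    (hα : aeval α (MonicCubic.poly a b c) = 0) (h3 : finrank ℚ K = 3)
    {p : ℕ} (hp : p.Prime) {z₀ z₁ z₂ : ℤ} (t₀ : ℤ) {t₁ t₂ : ℤ}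
    (hkill : KillValidAt p a b c (z₀, z₁, z₂) t₁ t₂)
    (hz : (z₀, z₁, z₂) ≠ ((0 : ℤ), (0 : ℤ), (0 : ℤ))) (x : ℚ) :
    ¬ IsSquare ((algebraMap ℚ K x - ((t₀ : K) + (t₁ : K) * α + (t₂ : K) * α ^ 2)) *
        ((z₀ : K) + (z₁ : K) * α + (z₂ : K) * α ^ 2)) := by
  classical
  rintro ⟨w, hw⟩
  have hrel := MonicCubic.theta_rel hα
  have hlin := powIndep_algebraMap hirr hα h3
  set Θ : K := (t₀ : K) + (t₁ : K) * α + (t₂ : K) * α ^ 2 with hΘ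
  set Z : K := (z₀ : K) + (z₁ : K) * α + (z₂ : K) * α ^ 2 with hZdef
  -- `z ≠ 0` in `K`
  have hZ : Z ≠ 0 := by
    intro h0
    have e : algebraMap ℚ K (z₂ : ℚ) * α ^ 2 + algebraMap ℚ K (z₁ : ℚ) * α +
        algebraMap ℚ K (z₀ : ℚ) = 0 := by
      simp only [map_intCast]; linear_combination h0
    obtain ⟨e₀, e₁, e₂⟩ := hlin _ _ _ e
    exact hz (Prod.ext (by exact_mod_cast e₀) (Prod.ext (by exact_mod_cast e₁) (by exact_mod_cast e₂)))
  -- `x − θ = z ρ²`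
  set ρ : K := w / Z with hρ
  have hZρ : Z * ρ ^ 2 = algebraMap ℚ K x - Θ := by
    have h1 : Z * ρ ^ 2 = (w * w) / Z := by rw [hρ]; field_simp
    rw [h1, ← hw]; field_simp
  -- `ρ = (r₀ + r₁α + r₂α²)/n` with `n ≥ 1` minimal
  obtain ⟨c₀, c₁, c₂, hc⟩ := exists_coords hirr hα h3 ρ
  have hP : ∃ n : ℕ, 0 < n ∧ ∃ r₀ r₁ r₂ : ℤ,
      (n : K) * ρ = (r₀ : K) + (r₁ : K) * α + (r₂ : K) * α ^ 2 := by
    obtain ⟨n, hn, r₀, r₁, r₂, f₀, f₁, f₂⟩ := exists_common_den c₀ c₁ c₂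
    refine ⟨n, hn, r₀, r₁, r₂, ?_⟩
    have g₀ : (n : K) * algebraMap ℚ K c₀ = (r₀ : K) := by
      rw [← map_natCast (algebraMap ℚ K), ← map_mul, f₀, map_intCast]
    have g₁ : (n : K) * algebraMap ℚ K c₁ = (r₁ : K) := by
      rw [← map_natCast (algebraMap ℚ K), ← map_mul, f₁, map_intCast]
    have g₂ : (n : K) * algebraMap ℚ K c₂ = (r₂ : K) := by
      rw [← map_natCast (algebraMap ℚ K), ← map_mul, f₂, map_intCast]
    rw [hc]
    linear_combination g₀ + g₁ * α + g₂ * α ^ 2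
  obtain ⟨hn0, r₀, r₁, r₂, hr⟩ := Nat.find_spec hP
  set n : ℕ := Nat.find hP with hn
  -- primitivity at `p` by minimality of `n`
  have hprim : ¬ ((p : ℤ) ∣ r₀ ∧ (p : ℤ) ∣ r₁ ∧ (p : ℤ) ∣ r₂ ∧ (p : ℤ) ∣ ((n : ℕ) : ℤ)) := by
    rintro ⟨⟨s₀, hs₀⟩, ⟨s₁, hs₁⟩, ⟨s₂, hs₂⟩, ⟨k, hk⟩⟩
    have hp0 : (0 : ℤ) < p := by exact_mod_cast hp.pos
    have hk0 : 0 < k := by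
      have h1 : (0 : ℤ) < p * k := by rw [← hk]; exact_mod_cast hn0
      exact pos_of_mul_pos_right h1 hp0.le
    have hkn : k.toNat < n := by
      have e1 : (k.toNat : ℤ) = k := Int.toNat_of_nonneg hk0.le
      have hp2 : (2 : ℤ) ≤ p := by exact_mod_cast hp.two_le
      have h2 : (k.toNat : ℤ) < ((n : ℕ) : ℤ) := by rw [e1, hk]; nlinarith
      exact_mod_cast h2
    refine Nat.find_min hP hkn ⟨by omega, s₀, s₁, s₂, ?_⟩
    have hpK : (p : K) ≠ 0 := by exact_mod_cast hp.ne_zero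
    have hnK : ((n : ℕ) : K) = (p : K) * (k.toNat : K) := by
      have e2 : ((n : ℕ) : ℤ) = p * (k.toNat : ℤ) := by rw [Int.toNat_of_nonneg hk0.le]; exact hk
      exact_mod_cast e2
    apply mul_left_cancel₀ hpK
    rw [← mul_assoc, ← hnK, hr, hs₀, hs₁, hs₂]
    push_cast
    ring
  -- the coordinate identity `z·(r₀ + r₁α + r₂α²)² = n²(x − θ)` on the power basis
  have hcast := map_zsq (Int.castRingHom K) a b c (z₀, z₁, z₂) (r₀, r₁, r₂)
  simp only [eq_intCast] at hcast
  have hev : ev α ((((zsq a b c (z₀, z₁, z₂) (r₀, r₁, r₂)).1 : ℤ) : K),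
      (((zsq a b c (z₀, z₁, z₂) (r₀, r₁, r₂)).2.1 : ℤ) : K),
      (((zsq a b c (z₀, z₁, z₂) (r₀, r₁, r₂)).2.2 : ℤ) : K)) =
      ((n : ℕ) : K) ^ 2 * (algebraMap ℚ K x - Θ) := by
    rw [hcast, ev_zsq hrel, ← hZρ]
    have e3 : ev α ((r₀ : K), (r₁ : K), (r₂ : K)) = (n : K) * ρ := by
      rw [hr]; simp only [ev]
    rw [e3, hZdef]
    simp only [ev]
    ring
  -- compare coordinates
  have hcomb : algebraMap ℚ K (((zsq a b c (z₀, z₁, z₂) (r₀, r₁, r₂)).2.2 : ℚ) + t₂ * (n : ℚ) ^ 2) * α ^ 2 +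
      algebraMap ℚ K (((zsq a b c (z₀, z₁, z₂) (r₀, r₁, r₂)).2.1 : ℚ) + t₁ * (n : ℚ) ^ 2) * α +
      algebraMap ℚ K (((zsq a b c (z₀, z₁, z₂) (r₀, r₁, r₂)).1 : ℚ) + (t₀ - x) * (n : ℚ) ^ 2) = 0 := by
    simp only [map_add, map_mul, map_sub, map_pow, map_intCast, map_natCast]
    simp only [ev] at hev
    linear_combination hev
  obtain ⟨-, e₁, e₂⟩ := hlin _ _ _ hcomb
  have hq : killQ a b c (z₀, z₁, z₂) t₁ t₂ (r₀, r₁, r₂, ((n : ℕ) : ℤ)) = 0 := by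
    refine Prod.ext ?_ ?_
    · have : ((zsq a b c (z₀, z₁, z₂) (r₀, r₁, r₂)).2.1 : ℤ) + t₁ * ((n : ℕ) : ℤ) ^ 2 = 0 := by
        exact_mod_cast e₁
      simpa [killQ] using this
    · have : ((zsq a b c (z₀, z₁, z₂) (r₀, r₁, r₂)).2.2 : ℤ) + t₂ * ((n : ℕ) : ℤ) ^ 2 = 0 := by
        exact_mod_cast e₂
      simpa [killQ] using this
  exact hkill (r₀, r₁, r₂, ((n : ℕ) : ℤ)) hprim hq


end Kill

section List

variable {K : Type*} [Field K] [NumberField K] {a b c : ℤ} {α : K}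

/-- **The list certificate in validity form**: for each entry, `p` is prime, the coordinates multiply out to
`z`, and `z ≠ 0` — NO residue search and no prime list (the validity of each entry is supplied separately).
Evaluated by `decide`. [folklore] -/
def killListCheckV (a b c : ℤ) {m : ℕ} (cu : Fin m → ℤ × ℤ × ℤ) {s : ℕ} (cg : Fin s → ℤ × ℤ × ℤ)
    (L : List (KillEntry m s)) : Bool :=
  L.all fun e => decide (e.p.Prime) && decide (prodCoords a b c cu cg e.T e.U = e.z) &&
    decide (e.z ≠ ((0 : ℤ), (0 : ℤ), (0 : ℤ)))

/-- Per-entry validity of the empty kill list. [folklore] -/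
theorem killValidList_nil {t₁ t₂ : ℤ} {m s : ℕ} :
    ∀ e ∈ ([] : List (KillEntry m s)), KillValidAt e.p a b c e.z t₁ t₂ := by
  simp

/-- Per-entry validity, one more kill. [folklore] -/
theorem killValidList_cons {t₁ t₂ : ℤ} {m s : ℕ} {k : KillEntry m s} {ks : List (KillEntry m s)}
    (hk : KillValidAt k.p a b c k.z t₁ t₂) (h : ∀ e ∈ ks, KillValidAt e.p a b c e.z t₁ t₂) :
    ∀ e ∈ k :: ks, KillValidAt e.p a b c e.z t₁ t₂ := by
  intro e he
  rcases List.mem_cons.mp he with rfl | he'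
  · exact hk
  · exact h e he'

/-- The landed list certificate is the validity form plus per-entry validity. [cite: CremonaAlgorithms1997, §3.6] -/
theorem killListCheckV_of_killListCheck {t₁ t₂ : ℤ} {m s : ℕ} {cu : Fin m → ℤ × ℤ × ℤ}
    {cg : Fin s → ℤ × ℤ × ℤ} {L : List (KillEntry m s)}
    (hL : killListCheck a b c t₁ t₂ cu cg L = true) :
    killListCheckV a b c cu cg L = true ∧ ∀ e ∈ L, KillValidAt e.p a b c e.z t₁ t₂ := by
  rw [killListCheck, List.all_eq_true] at hL
  refine ⟨?_, ?_⟩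
  · rw [killListCheckV, List.all_eq_true]
    intro e he
    have h := hL e he
    simp only [Bool.and_eq_true, decide_eq_true_eq] at h ⊢
    obtain ⟨⟨⟨hp, hz⟩, hz0⟩, -⟩ := h
    exact ⟨⟨prime_of_mem_killPrimes hp, hz⟩, hz0⟩
  · intro e he
    have h := hL e he
    simp only [Bool.and_eq_true, decide_eq_true_eq] at h
    obtain ⟨⟨⟨hp, -⟩, -⟩, hk⟩ := h
    exact killValidAt_of_killCheck (prime_of_mem_killPrimes hp) hk

/-- **Soundness of the multi-kill sieve, validity form.** As the landed `admKills_sound`, with the list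
certificate `killListCheckV` and the validity of every entry as hypotheses: a class `(T, U)` met by a
rational point is admissible and is none of the listed classes. [cite: Cassels1991LecturesEllipticCurves, §15] -/
theorem admKillsV_sound (hirr : Irreducible (MonicCubic.polyQ a b c))
    (hα : aeval α (MonicCubic.poly a b c) = 0) (h3 : finrank ℚ K = 3)
    (t₀ : ℤ) {t₁ t₂ : ℤ} {m s : ℕ} (u : Fin m → 𝓞 K) (G : Fin s → 𝓞 K)
    {cu : Fin m → ℤ × ℤ × ℤ} {cg : Fin s → ℤ × ℤ × ℤ}
    (hu : ∀ i, u i = lin hα (cu i).1 (cu i).2.1 (cu i).2.2)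
    (hG : ∀ j, G j = lin hα (cg j).1 (cg j).2.1 (cg j).2.2)
    {L : List (KillEntry m s)} (hL : killListCheckV a b c cu cg L = true)
    (hV : ∀ e ∈ L, KillValidAt e.p a b c e.z t₁ t₂)
    {adm : Finset (Fin m) → Finset (Fin s) → Bool} {T : Finset (Fin m)} {U : Finset (Fin s)}
    (hadm : adm T U = true) (x : ℚ)
    (hsq : IsSquare ((algebraMap ℚ K x - algebraMap (𝓞 K) K (lin hα t₀ t₁ t₂)) *
      (∏ i ∈ T, algebraMap (𝓞 K) K (u i)) * ∏ j ∈ U, algebraMap (𝓞 K) K (G j))) :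
    admKills adm L T U = true := by
  classical
  simp only [admKills, hadm, Bool.true_and, decide_eq_true_eq]
  rintro e he ⟨rfl, rfl⟩
  have hrel := MonicCubic.theta_rel hα
  have he' := List.all_eq_true.mp hL e he
  simp only [Bool.and_eq_true, decide_eq_true_eq] at he'
  obtain ⟨⟨hp, hz⟩, hz0⟩ := he'
  have hk := hV e he
  rw [prod_eq_evZ hrel e.T cu _ (fun i => by rw [hu, algebraMap_lin_evZ]),
    prod_eq_evZ hrel e.U cg _ (fun j => by rw [hG, algebraMap_lin_evZ]), mul_assoc,
    ← evZ_mul3 hrel, algebraMap_lin] at hsq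
  change IsSquare (_ * evZ α (prodCoords a b c cu cg e.T e.U)) at hsq
  rw [hz] at hsq
  obtain ⟨T', U', ⟨z₀, z₁, z₂⟩, p, fuel⟩ := e
  exact not_isSquare_of_killValidAt hirr hα h3 hp t₀ hk hz0 x hsq


end List

end TwoDescCubic

end Summit.BirchSwinnertonDyer.BirchSwinnertonDyer.Rank2Observatory

end
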